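import Summits.BirchSwinnertonDyer.BirchSwinnertonDyer.Theorems.ClassRecordThreeRung62310y1Admissible
import Summits.BirchSwinnertonDyer.BirchSwinnertonDyer.Theorems.ClassRecordThreeRung62310y1HeightEval
import Summits.BirchSwinnertonDyer.BirchSwinnertonDyer.Theorems.ClassRecordThreeRung62310y1HeightEvalSigma
import Summits.BirchSwinnertonDyer.BirchSwinnertonDyer.Theorems.ClassRecordThreeRung62310y1HeightEvalFormalLog
import Literature.NumberTheory.EllipticCurves.PadicFormalLogOrder
import HarnessLib

/-!
# Route `ClassRecordThree`, crux `SchneiderAtThree` (item 19106): the BC5 rung `stub_rung_62310y1` PROVED modulo GZK —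
# a kernel-checked T3 witness (cell `bsd-stepL`, seat `bsd-stepL-reg3-eng` g2; `--supports stmt-BirchSwinnertonDyer-19106`)

HONEST FRAMING: BSD is not proved by any of this; the rung is ONE curve and closes nothing by itself; Schneider's
non-degeneracy conjecture (barrier `PAdicHeightNondegeneracy`) — the crux's class-wide content — is asserted NOWHERE.
What this file does is retire the last non-published hypothesis of the rung: the numerical content HH of the REG3CERT row
`62310y1@3` (kit j249075, EVIDENCE: `heightFourOneCoord = 3 + 2·3² + ⋯ + O(3⁵⁰)`) becomes a KERNEL THEOREM,
`heightFourOneCoord_Q_ne_zero`, by the `O(3²)` evaluator of parts 1–3 (`…HeightEval`, `…HeightEvalSigma`,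
`…HeightEvalFormalLog`): `q ≡ 6 (9)`, `C² ≡ 8 (9)`, `log_Ŵ(z(Q)) ≡ 3 (27)`, `w ≡ 72 (81)`, `σ² ≡ 18 (81)`,
`h ≡ 3 (9) ≠ 0`. Hence (theorems only, 0 defs, 0 facts):

* `norm_formalLog_zQ_sub_three_le` — `‖log_Ŵ(z(Q)) − 3‖₃ ≤ 3⁻³` for every `3`-integral model with `a₁ = a₂ = 1`
  (`z(Q) = 194325360/909043067`; cubic expansion of part 3 + one rational residue);
* `norm_logUnitParamSq_sub_le` — `‖w − 72‖₃ ≤ 3⁻⁴` for `W = ⟨1,1,1,30,−63⟩` and every `‖q‖₃ ≤ 3⁻¹`;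
* **`heightFourOneCoord_Q_ne_zero`** — HH: for every `q` with `q ≠ 0`, `‖q‖ < 1`, `j(q) = j(W)`,
  `heightFourOneCoord W 3 q x(Q) y(Q) ≠ 0`;
* **`certNonsplit_Q`** — `RegMult.CertNonsplit W 3 Q 1` UNCONDITIONALLY (the REG3CERT row as a theorem);
* **`rung_62310y1_of_GZK`** — `GZK → (ClassX11b W 3 → Ram W 3 → ¬ split(3) → ClassClosure.RegulatorNonvanishingAt W 3)`
  for `W = ⟨1,1,1,30,−63⟩`: the skeleton's `stub_rung_62310y1` from the PUBLISHED fact GZK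
  (`rank_eq_analyticRank_of_analyticRank_le_one`) alone — a proved rung of the crux outside the summit's known
  regime (BSD₃(62310y1) is in no printed theorem), i.e. a kernel T3 witness in the tribunal's sense
  (`witness := …rung_62310y1_of_GZK`; the `ClassX11b` binder carries `analyticRank = 1`, not provable in Lean today).

References: [SteinWuthrich2013] §4.2; [SilvermanATAEC1994] V.3, V.5.1; [SilvermanAEC2009] IV.1, IV.5–6, VII.3.4;
[Iwasawa1972PadicL] §4.4; [KolyvaginEulerSystems1990] Thm. A (GZK).
-/

open scoped Classical

open WeierstrassCurve Literature.NumberTheory.EllipticCurves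
  Literature.NumberTheory.EllipticCurves.Rank1Residual
  Literature.NumberTheory.EllipticCurves.SteinWuthrich2013
  Summit.BirchSwinnertonDyer.Rank1Residual
  Summit.BirchSwinnertonDyer.Rank1Residual.X11b

namespace Summit.BirchSwinnertonDyer.Rank1Residual.X11b.RegMult.Rung62310y1

/-! ### §0 Plumbing -/

/-- `ord_p n = k` from `p^k ∣ n` and `p^{k+1} ∤ n`. [folklore] -/
private theorem padicValNat_eq_of_dvd_of_not_dvd' {p n k : ℕ} [Fact p.Prime] (hn : n ≠ 0) (h1 : p ^ k ∣ n)
    (h2 : ¬ p ^ (k + 1) ∣ n) : padicValNat p n = k := by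
  have hle : k ≤ padicValNat p n := (padicValNat_dvd_iff_le hn).mp h1
  have hlt : ¬ k + 1 ≤ padicValNat p n := fun h => h2 ((padicValNat_dvd_iff_le hn).mpr h); omega

/-- `‖n/d‖₃ = (3^v)⁻¹` for naturals with `ord₃ n = v`, `3 ∤ d`. [folklore] -/
private theorem norm_natDiv_of_padicValNat' {n d v : ℕ} (hn : n ≠ 0) (hd : ¬ 3 ∣ d) (hv : padicValNat 3 n = v) :
    ‖((n : ℚ_[3]) / (d : ℚ_[3]))‖ = ((3 : ℝ) ^ v)⁻¹ := by
  have hd0 : d ≠ 0 := by rintro rfl; exact hd (dvd_zero 3)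
  have hd1 : ‖(d : ℚ_[3])‖ = 1 := by
    rw [Padic.norm_eq_zpow_neg_valuation (by exact_mod_cast hd0), Padic.valuation_natCast,
      padicValNat.eq_zero_of_not_dvd hd]; simp
  rw [norm_div, hd1, div_one, Padic.norm_eq_zpow_neg_valuation (by exact_mod_cast hn), Padic.valuation_natCast, hv,
    zpow_neg, zpow_natCast]
  norm_num

/-- Ultrametric inequality for differences. [folklore] -/
private theorem norm_sub_le_max₃ (a b : ℚ_[3]) : ‖a - b‖ ≤ max ‖a‖ ‖b‖ := by
  rw [sub_eq_add_neg, ← norm_neg b]; exact IsUltrametricDist.norm_add_le_max a (-b)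

/-! ### §1 The formal logarithm of `z(Q)` modulo `27` -/

/-- `z(Q) = −x(Q)/y(Q) = 194325360/909043067` in `ℚ₃`. [folklore] -/
theorem zQ_eq : -(((809689 / 57600 : ℚ) : ℚ_[3])) / (((-909043067 / 13824000 : ℚ) : ℚ_[3])) =
    ((194325360 : ℕ) : ℚ_[3]) / ((909043067 : ℕ) : ℚ_[3]) := by
  push_cast
  field_simp
  norm_num

/-- `‖z(Q)‖₃ = 3⁻¹` (`194325360 = 3·64775120`, `3 ∤ 64775120`, `3 ∤ 909043067`). [folklore] -/
theorem norm_zQ : ‖((194325360 : ℕ) : ℚ_[3]) / ((909043067 : ℕ) : ℚ_[3])‖ = 1 / 3 := by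
  rw [norm_natDiv_of_padicValNat' (v := 1) (by norm_num) (by norm_num)
    (padicValNat_eq_of_dvd_of_not_dvd' (by norm_num) (by norm_num) (by norm_num))]
  norm_num

/-- **`log_Ŵ(z(Q)) ≡ 3 (mod 27)`**: for every `3`-integral model `V/ℚ₃` with `a₁ = a₂ = 1`,
`‖V.padicFormalLog z(Q) − 3‖₃ ≤ 3⁻³` (part 3's cubic expansion, and `z + z²/2 + 2z³/3 − 3 =
−2070950083030692439224938649/751196190389509094731381763` has `3`-adic norm `3⁻³`). [cite: SilvermanAEC2009, IV.6.4] -/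
theorem norm_formalLog_zQ_sub_three_le (V : WeierstrassCurve ℚ_[3]) [V.IsIntegral ℤ_[3]] (ha1 : V.a₁ = 1)
    (ha2 : V.a₂ = 1) :
    ‖V.padicFormalLog (((194325360 : ℕ) : ℚ_[3]) / ((909043067 : ℕ) : ℚ_[3])) - 3‖ ≤ 1 / 27 := by
  set z : ℚ_[3] := ((194325360 : ℕ) : ℚ_[3]) / ((909043067 : ℕ) : ℚ_[3]) with hz
  have hzn : ‖z‖ ≤ 1 / 3 := norm_zQ.le
  have hcub := norm_padicFormalLog_sub_cubic_le V hzn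
  rw [ha1, ha2] at hcub
  have hr : z + (2 : ℚ_[3])⁻¹ * 1 * z ^ 2 + (3 : ℚ_[3])⁻¹ * (1 ^ 2 + 1) * z ^ 3 - 3 =
      -(((2070950083030692439224938649 : ℕ) : ℚ_[3]) / ((751196190389509094731381763 : ℕ) : ℚ_[3])) := by
    rw [hz]; push_cast; field_simp; norm_num
  have hrn : ‖-(((2070950083030692439224938649 : ℕ) : ℚ_[3]) / ((751196190389509094731381763 : ℕ) : ℚ_[3]))‖ =
      1 / 27 := by
    rw [norm_neg, norm_natDiv_of_padicValNat' (v := 3) (by norm_num) (by norm_num)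
      (padicValNat_eq_of_dvd_of_not_dvd' (by norm_num) (by norm_num) (by norm_num))]
    norm_num
  calc ‖V.padicFormalLog z - 3‖
      = ‖(V.padicFormalLog z - (z + (2 : ℚ_[3])⁻¹ * 1 * z ^ 2 + (3 : ℚ_[3])⁻¹ * (1 ^ 2 + 1) * z ^ 3)) +
          (z + (2 : ℚ_[3])⁻¹ * 1 * z ^ 2 + (3 : ℚ_[3])⁻¹ * (1 ^ 2 + 1) * z ^ 3 - 3)‖ := by congr 1; ring
    _ ≤ max ‖V.padicFormalLog z - (z + (2 : ℚ_[3])⁻¹ * 1 * z ^ 2 + (3 : ℚ_[3])⁻¹ * (1 ^ 2 + 1) * z ^ 3)‖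
          ‖z + (2 : ℚ_[3])⁻¹ * 1 * z ^ 2 + (3 : ℚ_[3])⁻¹ * (1 ^ 2 + 1) * z ^ 3 - 3‖ :=
        IsUltrametricDist.norm_add_le_max _ _
    _ ≤ 1 / 27 := max_le (hcub.trans (by norm_num)) (by rw [hr, hrn])

/-! ### §2 `w = log_Ŵ(z(Q))²/C² ≡ 72 (mod 81)` -/

/-- **`‖logUnitParamSq W 3 q x(Q) y(Q) − 72‖₃ ≤ 3⁻⁴`** for `W = ⟨1,1,1,30,−63⟩` and every `‖q‖₃ ≤ 3⁻¹`
(`L ≡ 3 (27) ⇒ L² ≡ 9 (81)`; `C² ≡ 8 (9)`, `‖C²‖ = 1`; `L² − 72C² = (L² − 9) − 72(C² − 8) − 567`).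
[cite: SteinWuthrich2013, §4.2] -/
theorem norm_logUnitParamSq_sub_le (W : WeierstrassCurve ℚ) (hW : W = ⟨1, 1, 1, 30, -63⟩) [W.IsElliptic]
    [W.IsGloballyMinimal] {q : ℚ_[3]} (hq : ‖q‖ ≤ 1 / 3) :
    ‖logUnitParamSq W 3 q (809689 / 57600) (-909043067 / 13824000) - 72‖ ≤ 1 / 81 := by
  subst hW
  rw [logUnitParamSq, zQ_eq]
  have hC := norm_uniformisationScaleSq_sub_eight_le hq
  set C2 := uniformisationScaleSq (⟨1, 1, 1, 30, -63⟩ : WeierstrassCurve ℚ) 3 q with hC2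
  have h8 : ‖(8 : ℚ_[3])‖ = 1 := by
    rw [show (8 : ℚ_[3]) = ((8 : ℕ) : ℚ_[3]) by norm_cast, Padic.norm_eq_zpow_neg_valuation (by norm_num),
      Padic.valuation_natCast, padicValNat.eq_zero_of_not_dvd (by norm_num)]; simp
  have hCn : ‖C2‖ = 1 := by
    rw [← h8]; exact Padic.norm_eq_of_norm_sub_lt_right (hC.trans_lt (by rw [h8]; norm_num))
  have hC0 : C2 ≠ 0 := by intro h; rw [h, norm_zero] at hCn; exact zero_ne_one hCn
  set V := (⟨1, 1, 1, 30, -63⟩ : WeierstrassCurve ℚ).baseChange ℚ_[3] with hV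
  have ha1 : V.a₁ = 1 := by rw [hV, WeierstrassCurve.baseChange, WeierstrassCurve.map_a₁]; simp
  have ha2 : V.a₂ = 1 := by rw [hV, WeierstrassCurve.baseChange, WeierstrassCurve.map_a₂]; simp
  have hL := norm_formalLog_zQ_sub_three_le V ha1 ha2
  set L := V.padicFormalLog (((194325360 : ℕ) : ℚ_[3]) / ((909043067 : ℕ) : ℚ_[3])) with hLdef
  rw [div_sub' hC0, norm_div, hCn, div_one]
  have h6 : ‖(6 : ℚ_[3])‖ ≤ 1 / 3 := by
    rw [show (6 : ℚ_[3]) = ((6 : ℤ) : ℚ_[3]) by norm_cast]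
    exact ((Padic.norm_int_le_pow_iff_dvd (p := 3) 6 1).mpr (by norm_num)).trans (by norm_num)
  have hL3 : ‖L + 3‖ ≤ 1 / 3 := by
    have : L + 3 = (L - 3) + 6 := by ring
    rw [this]; exact (IsUltrametricDist.norm_add_le_max _ _).trans (max_le (hL.trans (by norm_num)) h6)
  have hL9 : ‖L ^ 2 - 9‖ ≤ 1 / 81 := by
    have : L ^ 2 - 9 = (L - 3) * (L + 3) := by ring
    rw [this, norm_mul]
    calc ‖L - 3‖ * ‖L + 3‖ ≤ 1 / 27 * (1 / 3) := by gcongr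
      _ = 1 / 81 := by norm_num
  have h567 : ‖(567 : ℚ_[3])‖ ≤ 1 / 81 := by
    rw [show (567 : ℚ_[3]) = ((567 : ℤ) : ℚ_[3]) by norm_cast]
    exact ((Padic.norm_int_le_pow_iff_dvd (p := 3) 567 4).mpr (by norm_num)).trans (by norm_num)
  have h72 : ‖(72 : ℚ_[3])‖ ≤ 1 / 9 := by
    rw [show (72 : ℚ_[3]) = ((72 : ℤ) : ℚ_[3]) by norm_cast]
    exact ((Padic.norm_int_le_pow_iff_dvd (p := 3) 72 2).mpr (by norm_num)).trans (by norm_num)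
  have hsplit : L ^ 2 - C2 * 72 = (L ^ 2 - 9) - (C2 - 8) * 72 - 567 := by ring
  rw [hsplit]
  refine (norm_sub_le_max₃ _ _).trans (max_le ?_ h567)
  refine (norm_sub_le_max₃ _ _).trans (max_le hL9 ?_)
  rw [norm_mul]
  calc ‖C2 - 8‖ * ‖(72 : ℚ_[3])‖ ≤ 1 / 9 * (1 / 9) := by gcongr
    _ = 1 / 81 := by norm_num

/-! ### §3 HH, the certificate, and the rung -/

/-- **HH for the rung row `62310y1@3` as a KERNEL theorem**: for `W = ⟨1,1,1,30,−63⟩` and every `q ∈ ℚ₃` with `q ≠ 0`,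
`‖q‖ < 1`, `j(q) = j(W)` (THE Tate parameter), `heightFourOneCoord W 3 q x(Q) y(Q) ≠ 0` — the Stein–Wuthrich §4.2
height of `Q = 2P` is non-zero. This is the numerical content of the REG3CERT row (kit j249075 certified it to 49 digits;
the kernel needs the residue `h ≡ 3 mod 9`). [cite: SteinWuthrich2013, §4.2] [cite: SilvermanATAEC1994, Lemma V.5.1] -/
theorem heightFourOneCoord_Q_ne_zero (W : WeierstrassCurve ℚ) (hW : W = ⟨1, 1, 1, 30, -63⟩) [W.IsElliptic]
    [W.IsGloballyMinimal] {q : ℚ_[3]} (hq1 : ‖q‖ < 1) (hj : tateJ q = (W.j : ℚ_[3])) :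
    heightFourOneCoord W 3 q (809689 / 57600) (-909043067 / 13824000) ≠ 0 := by
  subst hW
  rw [j_W] at hj
  have hq6 := norm_tateParam_sub_six_le hq1 hj
  have h6 : ‖(6 : ℚ_[3])‖ ≤ 1 / 3 := by
    rw [show (6 : ℚ_[3]) = ((6 : ℤ) : ℚ_[3]) by norm_cast]
    exact ((Padic.norm_int_le_pow_iff_dvd (p := 3) 6 1).mpr (by norm_num)).trans (by norm_num)
  have hq : ‖q‖ ≤ 1 / 3 := by
    have : q = (q - 6) + 6 := by ring
    rw [this]; exact (IsUltrametricDist.norm_add_le_max _ _).trans (max_le (hq6.trans (by norm_num)) h6)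
  have hden : (809689 / 57600 : ℚ).den = 57600 := by
    have h := Rat.den_div_eq_of_coprime (a := 809689) (b := 57600) (by norm_num) (by norm_num)
    have h' : (((809689 : ℤ) : ℚ) / ((57600 : ℤ) : ℚ)) = (809689 / 57600 : ℚ) := by norm_num
    rw [h'] at h
    exact_mod_cast h
  exact heightFourOneCoord_ne_zero_of_norm_bounds _ q hden (norm_uniformisationScaleSq_sub_eight_le hq)
    (norm_tateSigmaSq_coshOfSq_sub_le hq (norm_logUnitParamSq_sub_le _ rfl hq))

/-- **The REG3CERT row `62310y1@3` as a THEOREM**: `RegMult.CertNonsplit W 3 Q 1` for `W = ⟨1,1,1,30,−63⟩`,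
`Q = (809689/240², −909043067/240³)` — admissibility (`…Rung62310y1Admissible`) and the height inequality
(`heightFourOneCoord_Q_ne_zero`), both kernel-checked; no hypothesis left. [cite: SteinWuthrich2013, §4.2] -/
theorem certNonsplit_Q (W : WeierstrassCurve ℚ) (hW : W = ⟨1, 1, 1, 30, -63⟩) [W.IsElliptic] [W.IsGloballyMinimal]
    (h : W.toAffine.Nonsingular (809689 / 57600) (-909043067 / 13824000)) :
    RegMult.CertNonsplit W 3 (.some (809689 / 57600) (-909043067 / 13824000) h) 1 :=
  certNonsplit_Q_of_heightFourOneCoord_ne_zero W hW h fun _ _ hq1 hqj => heightFourOneCoord_Q_ne_zero W hW hq1 hqj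

/-- **The BC5 rung `stub_rung_62310y1` of crux `SchneiderAtThree` (item 19106), modulo GZK only.** For
`W = ⟨1,1,1,30,−63⟩` (Cremona 62310y1: non-split multiplicative at `3`, (ram) via `ℓ = 5`, `r_an = 1`):
`ClassX11b W 3 → Ram W 3 → ¬ split(3) → ClassClosure.RegulatorNonvanishingAt W 3` from the PUBLISHED fact GZK
(`rank_eq_analyticRank_of_analyticRank_le_one`: rank one on class X11b) — Schneider's conjecture for THE canonical
cyclotomic `3`-adic height of this one curve, the certificate `certNonsplit_Q` supplying an anisotropic point. A
proved rung of the crux outside the summit's known regime (no printed `p`-part theorem covers BSD₃ at `N = 62310`);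
nothing class-wide is asserted and no census word moves. [cite: SteinWuthrich2013, §4.2 and Conj. 4.1]
[cite: KolyvaginEulerSystems1990, Thm. A] -/
theorem rung_62310y1_of_GZK (hGZK : rank_eq_analyticRank_of_analyticRank_le_one) (W : WeierstrassCurve ℚ)
    (hW : W = ⟨1, 1, 1, 30, -63⟩) [W.IsElliptic] [W.IsGloballyMinimal] :
    ClassX11b W 3 → Ram W 3 → ¬ W.HasSplitMultiplicativeReductionAtPrime 3 →
      ClassClosure.RegulatorNonvanishingAt W 3 :=
  rung_62310y1_of_GZK_of_heightFourOneCoord_ne_zero hGZK W hW fun _ _ hq1 hqj => heightFourOneCoord_Q_ne_zero W hW hq1 hqj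

end Summit.BirchSwinnertonDyer.Rank1Residual.X11b.RegMult.Rung62310y1
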